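import Summits.MatrixMultiplication.OmegaCensus.STPP222TetraClauses
import Mathlib.Algebra.BigOperators.Group.Finset.Basic
import Mathlib.Tactic.IntervalCases

/-!
# ω-census, the pattern `(2,2,2)⁴`: reflection III — validity of the linear forms, the engine computes codes of group values

HONEST FRAMING (pub-omega census; verbatim): lottery ticket; floor = certified bounds/negative ranges.
Census STRUCTURE bookkeeping (question Q7, row `k = 4`: a KERNEL second leg for the lower half `n₄ ≥ 56` on the one cell,
`(ℤ/2)⁵`, that no second census engine reaches), not progress on `ω`.

Port of `STPP222CubeValid.lean` to four triples and homomorphic encodings: the linear expansion of a Def-5.1 word (`gword_of_valid`), the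
decidable VALIDITY predicate `linValid` / `levelValid` relating index tuples and linear forms, agreement of partial configurations with
an assignment, and `linForb_eq`: on an agreeing configuration the engine's forbidden code is the code of `∓(Σ plus − Σ minus)`.

References: H. Cohn, R. Kleinberg, B. Szegedy, C. Umans, FOCS 2005 (arXiv:math/0511460), Def. 5.1.
Record: pub-omega HOME `pub-omega-eng2-g23/tetra/` (ENG2 gen 23, 2026-08-26): generators `k4gen.py` (clause lists; levels 0–12 are
literally the `(2,2,2)³` words), `search4.py` (Python mirror of this engine, node-for-node equal to the C census engine cfind v1.2
run WITHOUT symmetry flags on `(ℤ/2)⁵`: 48 024 nodes / 4 115 340 clause evaluations, INFEASIBLE), `gen5.py` (the `GL₅(𝔽₂)` cover maps).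
-/

open Literature.Computability.AlgebraicComplexity Finset

namespace Summit.MatrixMultiplication.OmegaCensus

namespace STPP222TetraNeg

/-! ## 3. Linear expansion of words and validity of the linear forms -/

/-- Position of a variable in the search order. -/
def V18.idx : V18 → ℕ
  | .a0 => 0 | .b0 => 1 | .c0 => 2 | .q1 => 3 | .r1 => 4 | .q1' => 5 | .r1' => 6 | .a1 => 7 | .q2 => 8 | .r2 => 9
  | .q2' => 10 | .r2' => 11 | .a2 => 12 | .q3 => 13 | .r3 => 14 | .q3' => 15 | .r3' => 16 | .a3 => 17

/-- All variables, in search order. -/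
def allV : List V18 :=
  [.a0, .b0, .c0, .q1, .r1, .q1', .r1', .a1, .q2, .r2, .q2', .r2', .a2, .q3, .r3, .q3', .r3', .a3]

/-- Every variable is listed. -/
theorem mem_allV (u : V18) : u ∈ allV := by cases u <;> simp [allV]

/-- The six signed entries of the word of an index tuple (`true` = `+`): `+A i es'`, `−A k es`, `+B j et'`, `−B i et`,
`+C k eu'`, `−C j eu`. -/
def sslots (ι : Idx4) : List (Option V18 × Bool) :=
  [(slotA ι.i ι.es', true), (slotA ι.k ι.es, false), (slotB ι.j ι.et', true), (slotB ι.i ι.et, false),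
   (slotC ι.k ι.eu', true), (slotC ι.j ι.eu, false)]

/-- Signed value. -/
def sgv {G : Type} [AddCommGroup G] (σ : Bool) (x : G) : G := if σ then x else -x

/-- Signed sum of a list of signed optional variables. -/
def lsum {G : Type} [AddCommGroup G] (val : V18 → G) (S : List (Option V18 × Bool)) : G :=
  S.foldr (fun p acc => sgv p.2 (oval val p.1) + acc) 0

/-- Integer coefficient of a variable in a list of signed optional variables. -/
def coefZ (S : List (Option V18 × Bool)) (u : V18) : ℤ :=
  S.foldr (fun p acc => (if p.1 = some u then (if p.2 then 1 else -1) else 0) + acc) 0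

/-- The word is the signed sum of its six signed entries. -/
theorem gword_eq_lsum {G : Type} [AddCommGroup G] (val : V18 → G) (ι : Idx4) :
    gword val ι = lsum val (sslots ι) := by
  simp only [gword, gA, gB, gC, lsum, sslots, List.foldr_cons, List.foldr_nil, sgv, Bool.false_eq_true, ite_false,
    ite_true, add_zero, sub_eq_add_neg]
  abel

/-- LINEAR EXPANSION: a signed sum is the coefficient-weighted sum over all variables. -/
theorem lsum_eq_sum {G : Type} [AddCommGroup G] (val : V18 → G) (S : List (Option V18 × Bool)) :
    lsum val S = ∑ u ∈ allV.toFinset, coefZ S u • val u := by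
  induction S with
  | nil => simp [lsum, coefZ]
  | cons p S ih =>
    obtain ⟨s, σ⟩ := p
    have hl : lsum val ((s, σ) :: S) = sgv σ (oval val s) + lsum val S := rfl
    have hc : ∀ u, coefZ ((s, σ) :: S) u = (if s = some u then (if σ then 1 else -1) else 0) + coefZ S u :=
      fun u => rfl
    rw [hl, ih]
    simp only [hc, add_zsmul, Finset.sum_add_distrib]
    congr 1
    cases s with
    | none => simp [oval, sgv]
    | some u₀ =>
      have hmem : u₀ ∈ allV.toFinset := by simp [mem_allV]
      simp only [Option.some.injEq, oval]
      rw [Finset.sum_eq_single u₀]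
      · cases σ <;> simp [sgv]
      · intro u _ hne; simp [Ne.symm hne]
      · intro h; exact absurd hmem h

/-- List sums are count-weighted sums over all variables. -/
theorem sum_map_eq_sum {G : Type} [AddCommGroup G] (val : V18 → G) (l : List V18) :
    (l.map val).sum = ∑ u ∈ allV.toFinset, (l.count u : ℤ) • val u := by
  induction l with
  | nil => simp
  | cons v l ih =>
    rw [List.map_cons, List.sum_cons, ih]
    have hmem : v ∈ allV.toFinset := by simp [mem_allV]
    have hc : ∀ u, ((List.count u (v :: l) : ℕ) : ℤ) = (if u = v then 1 else 0) + (l.count u : ℤ) := by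
      intro u
      rw [List.count_cons]
      by_cases h : u = v
      · subst h; simp; ring
      · simp [h, beq_eq_decide, Ne.symm h]
    simp only [hc, add_zsmul, Finset.sum_add_distrib]
    congr 1
    rw [Finset.sum_eq_single v]
    · simp
    · intro u _ hne; simp [hne]
    · intro h; exact absurd hmem h

/-- VALIDITY of a linear form `l` for index tuple `ι` at position `p` (decidable): the conclusion of `ι` fails; the
coefficient of the position's variable `v` in the word of `ι` is `+1`/`−1` as `l.pos`; every other variable has
coefficient `count plus − count minus`; `plus`, `minus` only contain earlier variables. -/
def linValid (p : ℕ) (ι : Idx4) (l : LinCl) : Bool :=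
  match allV[p]? with
  | none => false
  | some v =>
    !ι.concl && (coefZ (sslots ι) v == (if l.pos then 1 else -1)) &&
    (allV.all fun u => u == v || (coefZ (sslots ι) u == (l.plus.count u : ℤ) - (l.minus.count u : ℤ))) &&
    ((l.plus ++ l.minus).all fun u => decide (u.idx < p))

/-- Validity of a level: index tuples and linear forms correspond one to one. -/
def levelValid (p : ℕ) : List Idx4 → List LinCl → Bool
  | [], [] => true
  | ι :: L, l :: K => linValid p ι l && levelValid p L K
  | _, _ => false

/-- A valid level provides a valid index tuple for every linear form. -/
theorem exists_valid_of_mem {p : ℕ} {L : List Idx4} {K : List LinCl} (h : levelValid p L K = true) {l : LinCl}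
    (hl : l ∈ K) : ∃ ι, linValid p ι l = true := by
  induction K generalizing L with
  | nil => simp at hl
  | cons l' K ih =>
    cases L with
    | nil => simp [levelValid] at h
    | cons ι L =>
      simp only [levelValid, Bool.and_eq_true] at h
      rcases List.mem_cons.1 hl with rfl | hl
      · exact ⟨ι, h.1⟩
      · exact ih h.2 hl

/-- Position `p` holds variable `allV[p]`. -/
theorem idx_of_getElem? {p : ℕ} {v : V18} (h : allV[p]? = some v) : v.idx = p := by
  have hp : p < allV.length := by
    by_contra hc
    rw [List.getElem?_eq_none (Nat.le_of_not_lt hc)] at h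
    cases h
  simp only [allV, List.length_cons, List.length_nil] at hp
  interval_cases p <;> simp [allV] at h <;> subst h <;> rfl

/-- CONSEQUENCE OF VALIDITY: the word of `ι` is `± (value of the position's variable) + (Σ plus − Σ minus)`. -/
theorem gword_of_valid {G : Type} [AddCommGroup G] {p : ℕ} {ι : Idx4} {l : LinCl} (h : linValid p ι l = true)
    {v : V18} (hv : allV[p]? = some v) (val : V18 → G) :
    gword val ι = sgv l.pos (val v) + ((l.plus.map val).sum - (l.minus.map val).sum) := by
  simp only [linValid, hv, Bool.and_eq_true, Bool.not_eq_true', beq_iff_eq, List.all_eq_true, Bool.or_eq_true,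
    decide_eq_true_eq] at h
  obtain ⟨⟨⟨_, hcv⟩, hcu⟩, hlt⟩ := h
  have hvp := idx_of_getElem? hv
  have hv_plus : l.plus.count v = 0 := List.count_eq_zero.2 fun hm => by
    have := hlt v (List.mem_append.2 (.inl hm)); omega
  have hv_minus : l.minus.count v = 0 := List.count_eq_zero.2 fun hm => by
    have := hlt v (List.mem_append.2 (.inr hm)); omega
  rw [gword_eq_lsum, lsum_eq_sum, sum_map_eq_sum, sum_map_eq_sum, ← Finset.sum_sub_distrib]
  have hsgv : sgv l.pos (val v) = ∑ u ∈ allV.toFinset, (if u = v then (if l.pos then (1 : ℤ) else -1) else 0) • val u := by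
    rw [Finset.sum_eq_single v]
    · cases l.pos <;> simp [sgv]
    · intro u _ hne; simp [hne]
    · intro hn; exact absurd (by simp [mem_allV]) hn
  rw [hsgv, ← Finset.sum_add_distrib]
  refine Finset.sum_congr rfl fun u _ => ?_
  rw [show ∀ a b c : ℤ, a • val u + (b • val u - c • val u) = (a + (b - c)) • val u from
    fun a b c => by simp only [add_zsmul, sub_eq_add_neg, neg_zsmul]]
  congr 1
  by_cases hu : u = v
  · subst hu; rw [hcv, hv_plus, hv_minus]; simp
  · have := hcu u (mem_allV u)
    rcases this with h | h
    · exact absurd h hu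
    · rw [h]; simp [hu]

/-! ## 4. The engine computes codes of group values -/

/-- Reading a set entry. -/
theorem Cfg4.get_set (P : Cfg4) (v u : V18) (x : ℕ) : (P.set v x).get u = if u = v then x else P.get u := by
  cases v <;> cases u <;> rfl

/-- A partial configuration AGREES with the assignment below position `p`. -/
def Agrees {G : Type} [AddCommGroup G] (E : EncH G) (val : V18 → G) (P : Cfg4) (p : ℕ) : Prop :=
  ∀ u : V18, u.idx < p → P.get u = E.enc (val u)

/-- Agreement extends by setting the position's variable to its code. -/
theorem agrees_set {G : Type} [AddCommGroup G] (E : EncH G) (val : V18 → G) {P : Cfg4} {p : ℕ}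
    (h : Agrees E val P p) {v : V18} (hv : v.idx = p) : Agrees E val (P.set v (E.enc (val v))) (p + 1) := by
  intro u hu
  rw [Cfg4.get_set]
  by_cases huv : u = v
  · subst huv; simp
  · rw [if_neg huv]
    have : u.idx ≠ v.idx := fun e => huv (by cases u <;> cases v <;> first | rfl | exact absurd e (by decide))
    exact h u (by omega)

/-- `sumGet` unfolds. -/
theorem sumGet_cons (A : ArithH) (P : Cfg4) (v : V18) (l : List V18) (init : ℕ) :
    sumGet A P (v :: l) init = sumGet A P l (A.add init (P.get v)) := rfl

/-- `sumGet` computes the code of `g + Σ (values of the listed variables)` from the code of `g`. -/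
theorem sumGet_eq {G : Type} [AddCommGroup G] (E : EncH G) (val : V18 → G) (P : Cfg4) (l : List V18)
    (h : ∀ u ∈ l, P.get u = E.enc (val u)) (g : G) :
    sumGet E.A P l (E.enc g) = E.enc (g + (l.map val).sum) := by
  induction l generalizing g with
  | nil => simp [sumGet]
  | cons v l ih =>
    rw [sumGet_cons, h v (by simp), E.add_enc, ih (fun u hu => h u (List.mem_cons_of_mem _ hu))]
    simp [add_assoc]

/-- THE FORBIDDEN CODE of a linear form, on an agreeing configuration, is the code of `∓(Σ plus − Σ minus)`. -/
theorem linForb_eq {G : Type} [AddCommGroup G] (E : EncH G) (val : V18 → G) {P : Cfg4} {l : LinCl}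
    (hag : ∀ u ∈ l.plus ++ l.minus, P.get u = E.enc (val u)) :
    linForb E.A P l = E.enc (sgv (!l.pos) ((l.plus.map val).sum - (l.minus.map val).sum)) := by
  have hP : sumGet E.A P l.plus 0 = E.enc ((l.plus.map val).sum) := by
    rw [← E.enc_zero, sumGet_eq E val P l.plus (fun u hu => hag u (List.mem_append.2 (.inl hu))), zero_add]
  have hM : sumGet E.A P l.minus 0 = E.enc ((l.minus.map val).sum) := by
    rw [← E.enc_zero, sumGet_eq E val P l.minus (fun u hu => hag u (List.mem_append.2 (.inr hu))), zero_add]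
  have hw : wCode E.A P l = E.enc ((l.plus.map val).sum - (l.minus.map val).sum) := by
    unfold wCode
    rw [hP, hM, E.neg_enc, E.add_enc, sub_eq_add_neg]
  unfold linForb
  cases hpos : l.pos
  · simp only [hw, sgv, Bool.not_false, if_true]
  · simp only [hw, E.neg_enc, sgv, Bool.not_true]; rfl

/-- `linMask` unfolds. -/
theorem linMask_cons (A : ArithH) (P : Cfg4) (l : LinCl) (K : List LinCl) (m₀ : ℕ) :
    linMask A P (l :: K) m₀ = linMask A P K (m₀ ||| (1 <<< linForb A P l)) := rfl

/-- A set bit of a mask comes from `m₀` or from the forbidden code of a listed form. -/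
theorem of_testBit_linMask (A : ArithH) (P : Cfg4) (K : List LinCl) (m₀ x : ℕ)
    (h : (linMask A P K m₀).testBit x = true) : m₀.testBit x = true ∨ ∃ l ∈ K, linForb A P l = x := by
  induction K generalizing m₀ with
  | nil => exact .inl h
  | cons l K ih =>
    rw [linMask_cons] at h
    rcases ih _ h with h | ⟨l', hl', he⟩
    · rw [Nat.testBit_lor, Bool.or_eq_true, Nat.one_shiftLeft, Nat.testBit_two_pow] at h
      rcases h with h | h
      · exact .inl h
      · exact .inr ⟨l, by simp, (decide_eq_true_iff.1 h)⟩
    · exact .inr ⟨l', List.mem_cons_of_mem _ hl', he⟩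

end STPP222TetraNeg

end Summit.MatrixMultiplication.OmegaCensus
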